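import Literature.Analysis.FunctionSpaces.LittlewoodPaleySquareFunction
import Literature.Analysis.FunctionSpaces.LittlewoodPaleyLocalSplitting
import Literature.Analysis.FunctionSpaces.BesovLittlewoodPaleyApproximation
import Literature.Analysis.FunctionSpaces.FourierSobolevNorm
import Literature.Analysis.FluidPDE.TaoAveragedSobolev

/-!
# Stub F (`besovFloorBound`) for `PerpetualPump.Thesis`, part I: `H^s ⊂ Ḃ⁰_{∞,1} ⊂ L^∞` on `L²`

Support file (part 1 of the stub `besovFloorBound` of line `SketchIdeator2`, crux
stmt-NavierStokesRegularity-1832). The envelope amplitude of that line is built on the homogeneous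
Besov norm `‖u‖_{Ḃ⁰_{∞,1}} = ∑_{j ∈ ℤ} ‖Δ̇_j u‖_{L^∞}` (`eHomBesovNorm 0 ∞ 1`, Bahouri–Chemin–Danchin
2011, Def. 2.15) of the tempered distribution of an `L²` field. This file proves the two embeddings
through which that norm talks to the `H¹⁰` theory of Tao's averaged Navier–Stokes equation
(T. Tao, J. Amer. Math. Soc. 29 (2016), §1.1) and to the `L^∞` Type-I rate:

* `F.eLpNormDistrib_lpBlock_coe_le_two_mul_enorm`: `‖Δ̇_j f‖_{L²} ≤ 2 ‖f‖_{L²}` (`|φ_j| ≤ 2`,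
  Plancherel);
* `F.eLpNormDistrib_lpBlock_coe_le_of_sobolev`: `‖Δ̇_j f‖_{L²} ≤ 2 · 2^{-(j-1)s} ‖f‖_{H^s}` for
  `s ≥ 0` (`φ_j` lives where `|ξ| > 2^{j-1}`, so `(1+|ξ|²)^s ≥ 2^{2(j-1)s}` there);
* `F.exists_eHomBesovNorm_coe_le_sobolev`: **`H^s ⊂ Ḃ⁰_{∞,1}` for `s > d/2`** with a constant,
  `‖f‖_{Ḃ⁰_{∞,1}} ≤ C ‖f‖_{H^s}` for every `f ∈ L²` (Bernstein `‖Δ̇_j f‖_∞ ≲ 2^{jd/2} ‖Δ̇_j f‖₂`,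
  BCD Lemma 2.1, then the two geometric sums `j ≤ 0`, `j ≥ 1`); in particular the envelope of an
  `H¹⁰(ℝ³)` field is **finite** (`F.eHomBesovNorm_coe_lt_top_of_sobolev`);
* `F.eLpNorm_coe_le_eHomBesovNorm`: **`Ḃ⁰_{∞,1} ∩ L² ⊂ L^∞`**, `‖f‖_{L^∞} ≤ ‖f‖_{Ḃ⁰_{∞,1}}` for
  every `f ∈ L²` (`L² ⊂ 𝓢'_h`, BCD Def. 1.26, and the `ℓ¹` summation of the blocks, Danchin 2018,
  Prop. 2.2 (i)); here `‖f‖_{L^∞}` is the genuine `eLpNorm · ∞ volume` of the `L²` class.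

The registered sub-goal `stub_besovFloorBound_Embed` records the `ℝ³`, `s = 10` instances over
Tao's `L2C = L²(ℝ³; ℂ³)`.

## References

* H. Bahouri, J.-Y. Chemin, R. Danchin, *Fourier Analysis and Nonlinear PDE* (2011), Lemma 2.1,
  Def. 1.26, Def. 2.15, Prop. 2.20.
* R. Danchin, *Fourier analysis methods for the compressible Navier–Stokes equations* (2018),
  Prop. 2.2.
* T. Tao, J. Amer. Math. Soc. 29 (2016), 601–674, §1.1.
-/

noncomputable section

open MeasureTheory TemperedDistribution Filter Topology
open scoped SchwartzMap ENNReal NNReal FourierTransform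

set_option linter.dupNamespace false

namespace Summit.NavierStokesRegularity.NavierStokesRegularity.Theorems.PerpetualPumpThesis.F

open Literature.Analysis.FunctionSpaces

section General

variable {E : Type*} [NormedAddCommGroup E] [InnerProductSpace ℝ E] [FiniteDimensional ℝ E]
  [MeasurableSpace E] [BorelSpace E]
  {F : Type*} [NormedAddCommGroup F] [InnerProductSpace ℂ F] [CompleteSpace F]

/-! ### The blocks of an `L²` function -/

/-- **`‖Δ̇_j f‖_{L²} ≤ 2 ‖f‖_{L²}`** for `f ∈ L²` and every `j ∈ ℤ`: Plancherel for the multiplier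
`φ_j` with `|φ_j| ≤ 2`. -/
theorem eLpNormDistrib_lpBlock_coe_le_two_mul_enorm (f : Lp F 2 (volume : Measure E)) (j : ℤ) :
    eLpNormDistrib 2 (lpBlock j (f : 𝓢'(E, F))) ≤ 2 * ‖f‖ₑ := by
  rw [← ENNReal.pow_le_pow_left_iff two_ne_zero, lpBlock_apply,
    eLpNormDistrib_fourierMultiplierCLM_coe_sq (hasTemperateGrowth_dyadicSymbol j)
      (memLp_top_dyadicSymbol j) f, mul_pow, ← lintegral_enorm_fourier_sq f,
    ← lintegral_const_mul' _ _ (by simp)]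
  refine lintegral_mono fun ξ => mul_le_mul' ?_ le_rfl
  calc ‖dyadicSymbol j ξ‖ₑ ^ 2 ≤ 4 := enorm_dyadicSymbol_sq_le_four j ξ
    _ = 2 ^ 2 := by norm_num

/-- The square of the Fourier–Sobolev norm is the weighted Plancherel integral. -/
theorem eFourierSobolevNorm_sq (s : ℝ) (f : Lp F 2 (volume : Measure E)) :
    eFourierSobolevNorm s f ^ 2 =
      ∫⁻ ξ, ENNReal.ofReal ((1 + ‖ξ‖ ^ 2) ^ s) *
        ‖((𝓕 f : Lp F 2 (volume : Measure E)) : E → F) ξ‖ₑ ^ 2 := by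
  rw [eFourierSobolevNorm, ← ENNReal.rpow_natCast, ← ENNReal.rpow_mul]
  norm_num

omit [InnerProductSpace ℝ E] [FiniteDimensional ℝ E] [MeasurableSpace E] [BorelSpace E] in
/-- The weight comparison on the support of `φ_j`: if `2^{j-1} < |ξ|` and `0 ≤ s` then
`2^{2(j-1)s} ≤ (1+|ξ|²)^s`, in `ℝ≥0∞`. -/
theorem two_rpow_le_weight {s : ℝ} (hs : 0 ≤ s) {j : ℤ} {ξ : E} (hξ : (2 : ℝ) ^ (j - 1) < ‖ξ‖) :
    (2 : ℝ≥0∞) ^ (((j : ℝ) - 1) * s * 2) ≤ ENNReal.ofReal ((1 + ‖ξ‖ ^ 2) ^ s) := by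
  have h2 : (0 : ℝ) < (2 : ℝ) ^ (j - 1) := zpow_pos two_pos _
  have hreal : (2 : ℝ) ^ (((j : ℝ) - 1) * s * 2) ≤ (1 + ‖ξ‖ ^ 2) ^ s := by
    have hbase : ((2 : ℝ) ^ (j - 1)) ^ 2 ≤ 1 + ‖ξ‖ ^ 2 := by
      nlinarith [pow_le_pow_left₀ h2.le hξ.le 2, sq_nonneg ‖ξ‖]
    calc (2 : ℝ) ^ (((j : ℝ) - 1) * s * 2) = (((2 : ℝ) ^ (j - 1)) ^ 2) ^ s := by
          rw [← Real.rpow_intCast 2 (j - 1), ← Real.rpow_natCast, ← Real.rpow_mul two_pos.le,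
            ← Real.rpow_mul two_pos.le]
          push_cast
          ring_nf
      _ ≤ (1 + ‖ξ‖ ^ 2) ^ s := Real.rpow_le_rpow (by positivity) hbase hs
  calc (2 : ℝ≥0∞) ^ (((j : ℝ) - 1) * s * 2)
      = ENNReal.ofReal ((2 : ℝ) ^ (((j : ℝ) - 1) * s * 2)) := by
        rw [← ENNReal.ofReal_rpow_of_pos two_pos, ENNReal.ofReal_ofNat]
    _ ≤ ENNReal.ofReal ((1 + ‖ξ‖ ^ 2) ^ s) := ENNReal.ofReal_le_ofReal hreal

/-- **`‖Δ̇_j f‖_{L²} ≤ 2 · 2^{-(j-1)s} ‖f‖_{H^s}`** for `f ∈ L²`, `0 ≤ s` and every `j ∈ ℤ`: the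
symbol `φ_j` vanishes on `|ξ| ≤ 2^{j-1}` (BCD Prop. 2.10), where the Sobolev weight is at least
`2^{2(j-1)s}`; then Plancherel. -/
theorem eLpNormDistrib_lpBlock_coe_le_of_sobolev {s : ℝ} (hs : 0 ≤ s)
    (f : Lp F 2 (volume : Measure E)) (j : ℤ) :
    eLpNormDistrib 2 (lpBlock j (f : 𝓢'(E, F))) ≤
      2 * (2 : ℝ≥0∞) ^ (-(((j : ℝ) - 1) * s)) * eFourierSobolevNorm s f := by
  rw [← ENNReal.pow_le_pow_left_iff two_ne_zero, lpBlock_apply,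
    eLpNormDistrib_fourierMultiplierCLM_coe_sq (hasTemperateGrowth_dyadicSymbol j)
      (memLp_top_dyadicSymbol j) f, mul_pow, mul_pow, eFourierSobolevNorm_sq,
    ← lintegral_const_mul' _ _ (ENNReal.mul_ne_top (by simp) (ENNReal.pow_ne_top
      (ENNReal.rpow_ne_top_of_ne_zero two_ne_zero ENNReal.ofNat_ne_top)))]
  refine lintegral_mono fun ξ => ?_
  by_cases hξ : ‖ξ‖ ≤ (2 : ℝ) ^ (j - 1)
  · rw [dyadicSymbol_apply_of_norm_le_holds hξ]
    simp
  · rw [not_le] at hξ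
    have hw := two_rpow_le_weight hs hξ
    have hpow : ((2 : ℝ≥0∞) ^ (-(((j : ℝ) - 1) * s))) ^ 2 * (2 : ℝ≥0∞) ^ (((j : ℝ) - 1) * s * 2) = 1 := by
      rw [← ENNReal.rpow_natCast, ← ENNReal.rpow_mul, two_rpow_mul_two_rpow]
      push_cast
      rw [show -(((j : ℝ) - 1) * s) * 2 + ((j : ℝ) - 1) * s * 2 = 0 by ring, ENNReal.rpow_zero]
    calc ‖dyadicSymbol j ξ‖ₑ ^ 2 * ‖((𝓕 f : Lp F 2 (volume : Measure E)) : E → F) ξ‖ₑ ^ 2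
        ≤ 2 ^ 2 * 1 * ‖((𝓕 f : Lp F 2 (volume : Measure E)) : E → F) ξ‖ₑ ^ 2 := by
          gcongr
          calc ‖dyadicSymbol j ξ‖ₑ ^ 2 ≤ 4 := enorm_dyadicSymbol_sq_le_four j ξ
            _ = 2 ^ 2 * 1 := by norm_num
      _ = 2 ^ 2 * (((2 : ℝ≥0∞) ^ (-(((j : ℝ) - 1) * s))) ^ 2 *
            (2 : ℝ≥0∞) ^ (((j : ℝ) - 1) * s * 2)) *
            ‖((𝓕 f : Lp F 2 (volume : Measure E)) : E → F) ξ‖ₑ ^ 2 := by rw [hpow]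
      _ ≤ 2 ^ 2 * (((2 : ℝ≥0∞) ^ (-(((j : ℝ) - 1) * s))) ^ 2 *
            ENNReal.ofReal ((1 + ‖ξ‖ ^ 2) ^ s)) *
            ‖((𝓕 f : Lp F 2 (volume : Measure E)) : E → F) ξ‖ₑ ^ 2 := by gcongr
      _ = 2 ^ 2 * ((2 : ℝ≥0∞) ^ (-(((j : ℝ) - 1) * s))) ^ 2 *
            (ENNReal.ofReal ((1 + ‖ξ‖ ^ 2) ^ s) *
              ‖((𝓕 f : Lp F 2 (volume : Measure E)) : E → F) ξ‖ₑ ^ 2) := by ring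

/-- The Sobolev scale is monotone in the exponent: `‖f‖_{H^s} ≤ ‖f‖_{H^t}` for `s ≤ t`. -/
theorem eFourierSobolevNorm_mono' {s t : ℝ} (hst : s ≤ t) (f : Lp F 2 (volume : Measure E)) :
    eFourierSobolevNorm s f ≤ eFourierSobolevNorm t f := by
  unfold eFourierSobolevNorm
  refine ENNReal.rpow_le_rpow (lintegral_mono fun ξ => ?_) (by norm_num)
  exact mul_le_mul' (ENNReal.ofReal_le_ofReal
    (Real.rpow_le_rpow_of_exponent_le (le_add_of_nonneg_right (sq_nonneg _)) hst)) le_rfl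

/-- `‖f‖_{L²} ≤ ‖f‖_{H^s}` for `0 ≤ s`. -/
theorem enorm_le_eFourierSobolevNorm' {s : ℝ} (hs : 0 ≤ s) (f : Lp F 2 (volume : Measure E)) :
    ‖f‖ₑ ≤ eFourierSobolevNorm s f := by
  rw [← eFourierSobolevNorm_zero_eq_enorm]
  exact eFourierSobolevNorm_mono' hs f

/-! ### `H^s ⊂ Ḃ⁰_{∞,1}` for `s > d/2` -/

/-- The exponent bookkeeping of the two geometric sums: with `d ≥ 1`, `d/2 < s` and
`a = min (s - d/2) (1/2)`, for every `j ∈ ℤ` both `j d/2 - (j-1) s ≤ s - a|j|` (used for `j ≥ 1`)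
and `j d / 2 ≤ s - a |j|` (used for `j ≤ 0`) hold in the relevant range. -/
theorem exponent_le {d s : ℝ} (hd : 1 ≤ d) (hs : d / 2 < s) (j : ℤ) :
    (1 ≤ j → (j : ℝ) * d / 2 + -(((j : ℝ) - 1) * s) ≤ s - min (s - d / 2) (1 / 2) * |(j : ℝ)|) ∧
    (j ≤ 0 → (j : ℝ) * d / 2 ≤ s - min (s - d / 2) (1 / 2) * |(j : ℝ)|) := by
  constructor
  · intro hj
    have hj' : (1 : ℝ) ≤ j := by exact_mod_cast hj
    rw [abs_of_pos (by linarith)]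
    nlinarith [min_le_left (s - d / 2) (1 / 2), hj']
  · intro hj
    have hj' : (j : ℝ) ≤ 0 := by exact_mod_cast hj
    rw [abs_of_nonpos hj']
    have hmin : min (s - d / 2) (1 / 2) ≤ 1 / 2 := min_le_right _ _
    have hspos : 0 ≤ s := by linarith
    nlinarith

/-- **`H^s ⊂ Ḃ⁰_{∞,1}` for `s > d/2`, with a constant** (`d = dim E ≥ 1`): there is `C` such that
`‖f‖_{Ḃ⁰_{∞,1}} ≤ C ‖f‖_{H^s}` for every `f ∈ L²(E; F)`. Block by block, Bernstein's inequality
`‖Δ̇_j f‖_∞ ≤ C_B 2^{jd/2} ‖Δ̇_j f‖₂` (BCD Lemma 2.1) is combined with `‖Δ̇_j f‖₂ ≤ 2‖f‖₂` for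
`j ≤ 0` and with `‖Δ̇_j f‖₂ ≤ 2 · 2^{-(j-1)s} ‖f‖_{H^s}` for `j ≥ 1`; both tails are geometric with
ratio `2^{-a}`, `a = min (s - d/2) (1/2) > 0`. -/
theorem exists_eHomBesovNorm_coe_le_sobolev [Nontrivial E] {s : ℝ}
    (hs : (Module.finrank ℝ E : ℝ) / 2 < s) :
    ∃ C : ℝ≥0, ∀ f : Lp F 2 (volume : Measure E),
      eHomBesovNorm 0 ∞ 1 (f : 𝓢'(E, F)) ≤ C * eFourierSobolevNorm s f := by
  set d : ℕ := Module.finrank ℝ E with hd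
  have hd1 : (1 : ℝ) ≤ d := by exact_mod_cast (Module.finrank_pos (R := ℝ) (M := E))
  have hs0 : 0 ≤ s := by
    have : (0 : ℝ) ≤ (d : ℝ) / 2 := by positivity
    linarith
  set a : ℝ := min (s - d / 2) (1 / 2) with ha
  have ha0 : 0 < a := lt_min (by linarith) (by norm_num)
  set r : ℝ≥0∞ := (2 : ℝ≥0∞) ^ (-a) with hr
  have hr1 : r < 1 := by
    rw [hr]
    exact ENNReal.rpow_lt_one_of_one_lt_of_neg (by norm_num) (by linarith)
  obtain ⟨CB, -, hCB⟩ := exists_eLpNormDistrib_lpBlock_le (E := E) (F := F) 2 ∞ le_top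
  -- the summable majorant
  set S : ℝ≥0∞ := ∑' j : ℤ, r ^ j.natAbs with hS
  have hSfin : S ≠ ⊤ := by
    refine (lt_of_le_of_lt (tsum_int_pow_natAbs_le r) ?_).ne
    refine ENNReal.mul_lt_top (by simp) (ENNReal.inv_lt_top.2 ?_)
    exact tsub_pos_of_lt hr1
  set K : ℝ≥0∞ := (CB : ℝ≥0∞) * (2 * (2 : ℝ≥0∞) ^ s) * S with hK
  have hKfin : K ≠ ⊤ := by
    refine ENNReal.mul_ne_top (ENNReal.mul_ne_top ENNReal.coe_ne_top
      (ENNReal.mul_ne_top (by simp) ?_)) hSfin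
    exact ENNReal.rpow_ne_top_of_nonneg hs0 (by simp)
  refine ⟨K.toNNReal, fun f => ?_⟩
  rw [ENNReal.coe_toNNReal hKfin, eHomBesovNorm_zero_one_eq_tsum]
  -- the blockwise bound
  have hexp : ∀ j : ℤ, (j : ℝ) * d * ((2 : ℝ≥0∞).toReal⁻¹ - (∞ : ℝ≥0∞).toReal⁻¹) = (j : ℝ) * d / 2 := by
    intro j
    simp only [ENNReal.toReal_ofNat, ENNReal.toReal_top, inv_zero, sub_zero]
    ring
  have hrpow : ∀ j : ℤ, r ^ j.natAbs = (2 : ℝ≥0∞) ^ (-(a * |(j : ℝ)|)) := by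
    intro j
    rw [hr, ← ENNReal.rpow_natCast, ← ENNReal.rpow_mul, Nat.cast_natAbs, Int.cast_abs]
    ring_nf
  have hblock : ∀ j : ℤ, eLpNormDistrib ∞ (lpBlock j (f : 𝓢'(E, F))) ≤
      (CB : ℝ≥0∞) * (2 * (2 : ℝ≥0∞) ^ s) * r ^ j.natAbs * eFourierSobolevNorm s f := by
    intro j
    have hB := hCB j (f : 𝓢'(E, F))
    rw [hexp j] at hB
    refine hB.trans ?_
    rw [hrpow j]
    rcases le_or_gt 1 j with hj | hj
    · -- high frequencies: the Sobolev bound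
      have h2 := eLpNormDistrib_lpBlock_coe_le_of_sobolev hs0 (F := F) f j
      have hle := (exponent_le hd1 hs j).1 hj
      calc (CB : ℝ≥0∞) * (2 : ℝ≥0∞) ^ ((j : ℝ) * d / 2) * eLpNormDistrib 2 (lpBlock j (f : 𝓢'(E, F)))
          ≤ (CB : ℝ≥0∞) * (2 : ℝ≥0∞) ^ ((j : ℝ) * d / 2) *
              (2 * (2 : ℝ≥0∞) ^ (-(((j : ℝ) - 1) * s)) * eFourierSobolevNorm s f) := by gcongr
        _ = (CB : ℝ≥0∞) * (2 * ((2 : ℝ≥0∞) ^ ((j : ℝ) * d / 2) *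
              (2 : ℝ≥0∞) ^ (-(((j : ℝ) - 1) * s)))) * eFourierSobolevNorm s f := by ring
        _ ≤ (CB : ℝ≥0∞) * (2 * ((2 : ℝ≥0∞) ^ s * (2 : ℝ≥0∞) ^ (-(a * |(j : ℝ)|)))) *
              eFourierSobolevNorm s f := by
            gcongr (CB : ℝ≥0∞) * (2 * ?_) * _
            rw [two_rpow_mul_two_rpow, two_rpow_mul_two_rpow]
            exact ENNReal.rpow_le_rpow_of_exponent_le (by norm_num) (by linarith)
        _ = (CB : ℝ≥0∞) * (2 * (2 : ℝ≥0∞) ^ s) * (2 : ℝ≥0∞) ^ (-(a * |(j : ℝ)|)) *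
              eFourierSobolevNorm s f := by ring
    · -- low frequencies: the `L²` bound
      have hj' : j ≤ 0 := by omega
      have h2 := eLpNormDistrib_lpBlock_coe_le_two_mul_enorm (F := F) f j
      have hle := (exponent_le hd1 hs j).2 hj'
      calc (CB : ℝ≥0∞) * (2 : ℝ≥0∞) ^ ((j : ℝ) * d / 2) * eLpNormDistrib 2 (lpBlock j (f : 𝓢'(E, F)))
          ≤ (CB : ℝ≥0∞) * (2 : ℝ≥0∞) ^ ((j : ℝ) * d / 2) * (2 * eFourierSobolevNorm s f) := by
            gcongr
            exact h2.trans (by gcongr; exact enorm_le_eFourierSobolevNorm' hs0 f)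
        _ = (CB : ℝ≥0∞) * (2 * (2 : ℝ≥0∞) ^ ((j : ℝ) * d / 2)) * eFourierSobolevNorm s f := by ring
        _ ≤ (CB : ℝ≥0∞) * (2 * ((2 : ℝ≥0∞) ^ s * (2 : ℝ≥0∞) ^ (-(a * |(j : ℝ)|)))) *
              eFourierSobolevNorm s f := by
            gcongr (CB : ℝ≥0∞) * (2 * ?_) * _
            rw [two_rpow_mul_two_rpow]
            exact ENNReal.rpow_le_rpow_of_exponent_le (by norm_num) (by linarith)
        _ = (CB : ℝ≥0∞) * (2 * (2 : ℝ≥0∞) ^ s) * (2 : ℝ≥0∞) ^ (-(a * |(j : ℝ)|)) *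
              eFourierSobolevNorm s f := by ring
  calc ∑' j : ℤ, eLpNormDistrib ∞ (lpBlock j (f : 𝓢'(E, F)))
      ≤ ∑' j : ℤ, (CB : ℝ≥0∞) * (2 * (2 : ℝ≥0∞) ^ s) * r ^ j.natAbs * eFourierSobolevNorm s f :=
        ENNReal.tsum_le_tsum hblock
    _ = (CB : ℝ≥0∞) * (2 * (2 : ℝ≥0∞) ^ s) * S * eFourierSobolevNorm s f := by
        rw [hS, ENNReal.tsum_mul_right, ENNReal.tsum_mul_left]

/-- **The `Ḃ⁰_{∞,1}` envelope of an `H^s` field, `s > d/2`, is finite.** -/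
theorem eHomBesovNorm_coe_lt_top_of_sobolev [Nontrivial E] {s : ℝ}
    (hs : (Module.finrank ℝ E : ℝ) / 2 < s) {f : Lp F 2 (volume : Measure E)}
    (hf : eFourierSobolevNorm s f < ⊤) : eHomBesovNorm 0 ∞ 1 (f : 𝓢'(E, F)) < ⊤ := by
  obtain ⟨C, hC⟩ := exists_eHomBesovNorm_coe_le_sobolev (E := E) (F := F) hs
  exact (hC f).trans_lt (ENNReal.mul_lt_top ENNReal.coe_lt_top hf)

/-! ### `Ḃ⁰_{∞,1} ∩ L² ⊂ L^∞` -/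

omit [InnerProductSpace ℂ F] in
/-- The distributional `L^p` norm of (the tempered distribution of) an `L²` class is the `L^p` norm
of the class, in `[0, ∞]` (the class is locally integrable and represents its distribution). -/
theorem eLpNormDistrib_coe_two_eq_eLpNorm [NormedSpace ℂ F] (p : ℝ≥0∞) [Fact (1 ≤ p)]
    (f : Lp F 2 (volume : Measure E)) :
    eLpNormDistrib p (f : 𝓢'(E, F)) = eLpNorm (f : E → F) p volume :=
  eLpNormDistrib_eq_eLpNorm_of_forall_apply_eq p ((Lp.memLp f).locallyIntegrable one_le_two)
    fun θ => Lp.toTemperedDistribution_apply f θ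

omit [InnerProductSpace ℂ F] in
/-- **`Ḃ⁰_{∞,1} ∩ L² ⊂ L^∞`**: `‖f‖_{L^∞} ≤ ‖f‖_{Ḃ⁰_{∞,1}}` for every `f ∈ L²(E; F)`, `dim E ≥ 1`
(`L² ⊂ 𝓢'_h`, i.e. `Ṡ_j f → 0` as `j → -∞`, BCD Def. 1.26; then `‖u‖_{L^∞} ≤ ∑_j ‖Δ̇_j u‖_{L^∞}`,
Danchin 2018, Prop. 2.2 (i)). Both sides may be `∞`. -/
theorem eLpNorm_coe_le_eHomBesovNorm [NormedSpace ℂ F] [Nontrivial E]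
    (f : Lp F 2 (volume : Measure E)) :
    eLpNorm (f : E → F) ∞ volume ≤ eHomBesovNorm 0 ∞ 1 (f : 𝓢'(E, F)) := by
  rw [← eLpNormDistrib_coe_two_eq_eLpNorm]
  exact eLpNormDistrib_le_eHomBesovNorm_zero_one _
    (tendsto_lowFreqCutoff_coe_atBot (p := 2) (by simp) f)

omit [InnerProductSpace ℂ F] in
/-- The class form: an `L²` field of finite `Ḃ⁰_{∞,1}` envelope is essentially bounded. -/
theorem memLp_top_of_eHomBesovNorm_lt_top [NormedSpace ℂ F] [Nontrivial E]
    {f : Lp F 2 (volume : Measure E)} (hf : eHomBesovNorm 0 ∞ 1 (f : 𝓢'(E, F)) < ⊤) :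
    MemLp (f : E → F) ∞ (volume : Measure E) :=
  ⟨(Lp.memLp f).aestronglyMeasurable, (eLpNorm_coe_le_eHomBesovNorm f).trans_lt hf⟩

end General

/-! ### The instances over Tao's `L2C = L²(ℝ³; ℂ³)` -/

section Tao

open Literature.Analysis.FluidPDE.Tao2016

/-- **`H¹⁰(ℝ³) ⊂ Ḃ⁰_{∞,1}`** on `L2C`, with a constant. -/
theorem exists_eHomBesovNorm_le_H10 :
    ∃ C : ℝ≥0, ∀ f : L2C,
      eHomBesovNorm 0 ∞ 1
          ((f : L2C) : 𝓢'(EuclideanSpace ℝ (Fin 3), EuclideanSpace ℂ (Fin 3))) ≤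
        C * eFourierSobolevNorm 10 f :=
  exists_eHomBesovNorm_coe_le_sobolev (E := EuclideanSpace ℝ (Fin 3))
    (F := EuclideanSpace ℂ (Fin 3)) (s := 10) (by rw [finrank_euclideanSpace_fin]; norm_num)

/-- The envelope `‖u‖_{Ḃ⁰_{∞,1}}` of a field of finite `H¹⁰` norm (e.g. `u ∈ H¹⁰_df`) is finite. -/
theorem eHomBesovNorm_lt_top_of_H10 {f : L2C} (hf : eFourierSobolevNorm 10 f < ⊤) :
    eHomBesovNorm 0 ∞ 1 ((f : L2C) : 𝓢'(EuclideanSpace ℝ (Fin 3), EuclideanSpace ℂ (Fin 3))) < ⊤ :=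
  eHomBesovNorm_coe_lt_top_of_sobolev (by rw [finrank_euclideanSpace_fin]; norm_num) hf

/-- **`Ḃ⁰_{∞,1} ⊂ L^∞` on `L2C`**: `‖f‖_{L^∞} ≤ ‖f‖_{Ḃ⁰_{∞,1}}`. -/
theorem eLpNorm_le_eHomBesovNorm_L2C (f : L2C) :
    eLpNorm (f : EuclideanSpace ℝ (Fin 3) → EuclideanSpace ℂ (Fin 3)) ⊤ volume ≤
      eHomBesovNorm 0 ∞ 1 ((f : L2C) : 𝓢'(EuclideanSpace ℝ (Fin 3), EuclideanSpace ℂ (Fin 3))) :=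
  eLpNorm_coe_le_eHomBesovNorm f

end Tao

end Summit.NavierStokesRegularity.NavierStokesRegularity.Theorems.PerpetualPumpThesis.F

namespace Summit.NavierStokesRegularity.NavierStokesRegularity.Theorems.PerpetualPumpThesis

open Literature.Analysis.FluidPDE Literature.Analysis.FluidPDE.Tao2016
open Literature.Analysis.FunctionSpaces

/-- **Part Embed of stub F (registered sub-goal `stub_besovFloorBound_Embed`)**: on
`L2C = L²(ℝ³; ℂ³)`, (i) `H¹⁰ ⊂ Ḃ⁰_{∞,1}` with a constant, `‖f‖_{Ḃ⁰_{∞,1}} ≤ C ‖f‖_{H¹⁰}`, and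
(ii) `Ḃ⁰_{∞,1} ⊂ L^∞`, `‖f‖_{L^∞} ≤ ‖f‖_{Ḃ⁰_{∞,1}}` — the envelope of the line `SketchIdeator2`
is finite on `H¹⁰_df` and dominates the `L^∞` Type-I rate. -/
theorem stub_besovFloorBound_Embed : (∃ C : NNReal, ∀ f : L2C, eHomBesovNorm 0 ⊤ 1 ((f : L2C) : 𝓢'(EuclideanSpace ℝ (Fin 3), EuclideanSpace ℂ (Fin 3))) ≤ (C : ENNReal) * eFourierSobolevNorm 10 f) ∧ ∀ f : L2C, eLpNorm (f : EuclideanSpace ℝ (Fin 3) → EuclideanSpace ℂ (Fin 3)) ⊤ volume ≤ eHomBesovNorm 0 ⊤ 1 ((f : L2C) : 𝓢'(EuclideanSpace ℝ (Fin 3), EuclideanSpace ℂ (Fin 3))) :=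
  ⟨F.exists_eHomBesovNorm_le_H10, F.eLpNorm_le_eHomBesovNorm_L2C⟩

end Summit.NavierStokesRegularity.NavierStokesRegularity.Theorems.PerpetualPumpThesis
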